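import Mathlib.Analysis.SpecialFunctions.BinaryEntropy
import Mathlib.Analysis.SpecificLimits.Basic
import Literature.Computability.FineGrained.FineGrainedWave0
import Literature.Computability.FineGrained.FineGrainedWave0Proofs
import Literature.Computability.Complexity.TM2Disjunction
import Literature.Computability.Complexity.TM2AnyList
import HarnessLib

/-!
# Impagliazzo–Paturi, `s_k ≤ (1 - d/k) s_∞`: Theorem 3 reduced to Lemma 2

Family `fine-grained` (trunk T-CPLX-FINE). This file decomposes the named fact
`Literature.Computability.FineGrained.satExponent_le_satExponentLimit` (`FineGrainedWave0.lean`; Impagliazzo–Paturi,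
*On the complexity of k-SAT*, JCSS 62 (2001), Theorem 3, p. 374) into the results its printed
proof invokes, vendored here as named facts, and PROVES the assembly
(`satExponent_le_satExponentLimit_of`): Theorem 3 follows from

* `kSATInExpTime_one` (`FineGrainedWave0.lean`; discharged in the tree,
  `kSATInExpTime_one_holds` of `SATBruteForceMachine.lean`, not imported here): exhaustive
  search, `s_k ≤ 1` — used for `s_k' ≤ s_∞ < ∞` and for the existence of a `k'`-SAT algorithm
  of exponent `< s_k' + ε` (the order-theoretic glue `s_k ≤ s_∞ ≤ 1` is
  `FineGrainedWave0Proofs.lean`);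
* `lightKSAT_exhaustiveSearch` (IP 2001, p. 370 and proof of Theorem 3, step 1): the assignments
  with at most `n/N` ones can be searched exhaustively in time `2^{h(1/N) n} · poly(L)`;
* `impagliazzoPaturi_lemma2` (IP 2001, Lemma 2, p. 373): if no assignment with fewer than `δ n`
  ones satisfies the k-CNF `F`, then `F` is equisatisfiable with a disjunction of at most
  `2^{2ε n}` (up to `poly(L)`) `k'`-CNFs on at most `n (1 - δ/(3k))` variables each, computable in
  time `2^{2ε n} · poly(L)` (the source prints `n (1 - δ/(ek))`; `3 ≥ e` gives the weaker, implied
  form, see the docstring);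
* two folklore machine-composition theorems over Mathlib's `Turing.FinTM2`
  (Arora–Barak 2009, §1.3), PROVED here from the toolkit files `TM2Disjunction.lean`
  (`Turing.TM2ComputableAux.or_outputsWithin`) and `TM2AnyList.lean`
  (`Turing.TM2ComputableAux.any_outputsWithin`): `computesInTime_or` (run two deciders on the
  same input, OR the answers) and `computesInTime_any` (run a decider on every entry of a
  computed, separator-delimited list, OR the answers), with additive running times.

The assembly is the printed proof of Theorem 3 (p. 374): with `δ = 1/N` chosen so that
`h(δ) ≤ s_∞ / 2` and `ε > 0`, the algorithm "(1) search the assignments with `≤ δ n` ones;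
(2) accept if one satisfies `F`; (3) otherwise apply Lemma 2; (4) solve each `F_i` by a `k'`-SAT
algorithm of exponent `< s_k' + ε`; (5) accept iff some `F_i` is satisfiable" decides k-SAT in
time `2^{h(δ) n} + 2^{2εn} + 2^{2εn} · 2^{(s_k' + ε)(1 - δ/(3k)) n}` up to `poly(L)`, whence
`s_k ≤ (1 - d/k) s_∞ + 3ε` with `d = δ/3`, and `ε → 0`. The real-analysis bookkeeping is done
through `KCNF.IsExpPolyDom ρ g` ("`g φ = O(2^{ρ n} poly(L))` over all k-CNFs `φ`"), closed under
sums, products (exponents add) and sums over the produced lists.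

Remaining named facts (each a `Turing.FinTM2` construction; the toolkit of
`Literature/Computability/Complexity/{TimeBoundsProofs, TM2Iterate, TM2Context, TM2Simulation,
Transducers, StackMachinesTM2}.lean` applies): `lightKSAT_exhaustiveSearch` and — the crux,
containing the sparsification lemma of Impagliazzo–Paturi–Zane, whose combinatorial half is
proved in `Sparsification.lean` — `impagliazzoPaturi_lemma2`. The assembly keeps
`kSATInExpTime_one` as a hypothesis (discharged in `SATBruteForceMachine.lean`).

## Design notes

* `lightKSAT_exhaustiveSearch` takes `δ = 1/N`: the machine has to compute the threshold
  `⌊δ n⌋` from `n`, which is impossible for a non-computable real `δ`; Theorem 3 only needs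
  `h(δ) → 0`. The exponent is the binary entropy in bits, `Real.binEntropy δ / Real.log 2`
  (Mathlib's `Real.binEntropy` is in nats).
* `impagliazzoPaturi_lemma2` keeps real `δ, ε > 0` but bounds the number of variables of the
  produced formulas by `n (1 - δ/(3k))` instead of the printed `n (1 - δ/(ek))` (weaker, as
  `e ≤ 3`): the construction enumerates vectors `(f_1, …, f_p)` with `Σ f_i` at least a threshold
  that the machine must compute from `n`; any rational threshold in `[δ n/(3k), δ n/(ek)]` will
  do, whereas `⌈δ n/(ek)⌉` itself involves `e`. The bounds on the number, size and running time
  are stated for all inputs (the construction does not use the hypothesis; only the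
  equisatisfiability does) and carry a `poly(L)` slack, as everywhere in this family
  (`IsExpPolyBound`).
* Mathlib anchors: the Hamming weight of an assignment is `hammingNorm` (with `0 = false` from
  the Boolean ring structure on `Bool`; `hammingNorm_eq_card_filter_eq_true`), the binary entropy
  is `Real.binEntropy` (`binEntropy_continuous`, `binEntropy_zero`), `Real.lt_sInf_add_pos`,
  `le_ciSup`. Nothing else here is in Mathlib (searched `satExponent`, `parsification`, `ETH`,
  `LightSatisfiable`: no Mathlib hits).

## References

* R. Impagliazzo, R. Paturi, *On the complexity of k-SAT*, J. Comput. System Sci. 62 (2001),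
  367–375, doi:10.1006/jcss.2000.1727: p. 370 (exhaustive search of light assignments in time
  `2^{h(δ) n}`), Lemma 2 (p. 373), Theorem 3 and its proof (p. 374).
* R. Impagliazzo, R. Paturi, F. Zane, *Which problems have strongly exponential complexity?*,
  JCSS 63 (2001), Theorem 1 / Corollary 1 (sparsification; used inside Lemma 2).
* S. Arora, B. Barak, *Computational Complexity: A Modern Approach*, CUP 2009, §1.3 (machine
  composition; cf. `Literature.Computability.Complexity.TimeComputable.comp`).
-/

namespace Literature.Computability.FineGrained

open _root_.Computability Turing Real Filter Topology

/-! ### `ComputesInTime`: bookkeeping -/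

section ComputesInTime

variable {α β Γ₀ Γ₁ : Type} {ea : α → List Γ₀} {eb : β → List Γ₁} {f g : α → β} {T T' : α → ℕ}

/-- Monotonicity of `ComputesInTime` in the (instance-dependent) time bound. [folklore] -/
theorem ComputesInTime.mono_time (h : ComputesInTime ea eb f T) (hT : ∀ a, T a ≤ T' a) :
    ComputesInTime ea eb f T' := by
  obtain ⟨M, hM⟩ := h
  refine ⟨M, fun a => ?_⟩
  obtain ⟨e⟩ := hM a
  exact ⟨⟨e.toEvalsTo, e.steps_le_m.trans (hT a)⟩⟩

/-- `ComputesInTime` only depends on the computed function extensionally. [folklore] -/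
theorem ComputesInTime.congr_fun (h : ComputesInTime ea eb f T) (hfg : ∀ a, f a = g a) :
    ComputesInTime ea eb g T := by
  obtain ⟨M, hM⟩ := h
  exact ⟨M, fun a => hfg a ▸ hM a⟩

end ComputesInTime

/-! ### Light satisfiability and the hypothesis of Lemma 2 -/

/-- The number of ones of a Boolean assignment `v` of `n` variables is its Hamming weight,
Mathlib's `hammingNorm v = #{i | v i ≠ 0}` for the Boolean ring structure of `Bool`
(`0 = false`): it is the number of variables set to `true`. [folklore] -/
theorem hammingNorm_eq_card_filter_eq_true {n : ℕ} (v : Fin n → Bool) :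
    hammingNorm v = (Finset.univ.filter fun i => v i = true).card := by
  simp only [hammingNorm, ne_eq]
  congr 1
  ext i
  simp [show (0 : Bool) = false from rfl]

/-- An assignment of `n` variables has at most `n` ones. [folklore] -/
theorem hammingNorm_fin_bool_le {n : ℕ} (v : Fin n → Bool) : hammingNorm v ≤ n := by
  simpa using (hammingNorm_le_card_fintype (x := v))

namespace KCNF

variable {k : ℕ}

/-- Evaluate a k-CNF under an assignment of exactly its `numVars` variables (extended by
`false`, as in `KCNF.Satisfiable`). [folklore] -/
def evalFin (φ : KCNF k) (v : Fin φ.numVars → Bool) : Bool :=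
  φ.eval fun i => if h : i < φ.numVars then v ⟨i, h⟩ else false

/-- `KCNF.Satisfiable` is the existence of a satisfying `Fin numVars`-assignment (definitional). [folklore] -/
theorem satisfiable_iff_exists_evalFin (φ : KCNF k) :
    φ.Satisfiable ↔ ∃ v : Fin φ.numVars → Bool, φ.evalFin v = true :=
  Iff.rfl

/-- `φ.LightSatisfiable w`: `φ` has a satisfying assignment with at most `w` ones (Hamming
weight `hammingNorm v ≤ w`) — the event
tested by step 1 of the algorithm of Impagliazzo–Paturi 2001, Theorem 3 ("check if any
assignment with at most `δ n` 1's satisfies `F`").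
[cite: ImpagliazzoPaturiJCSS2001, p. 370 and proof of Theorem 3, step 1 (p. 374)] -/
def LightSatisfiable (φ : KCNF k) (w : ℕ) : Prop :=
  ∃ v : Fin φ.numVars → Bool, hammingNorm v ≤ w ∧ φ.evalFin v = true

/-- `instance`: light satisfiability is decidable (finitely many assignments). [folklore] -/
instance (φ : KCNF k) (w : ℕ) : Decidable (φ.LightSatisfiable w) :=
  inferInstanceAs (Decidable (∃ _ : Fin φ.numVars → Bool, _))

/-- A lightly satisfiable formula is satisfiable. [folklore] -/
theorem LightSatisfiable.satisfiable {φ : KCNF k} {w : ℕ} (h : φ.LightSatisfiable w) :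
    φ.Satisfiable := by
  obtain ⟨v, -, hv⟩ := h
  exact ⟨v, hv⟩

/-- `φ.NoLightSat δ`: "`F` is not satisfiable by any assignment that contains fewer than `δ n`
1's" — the hypothesis of Impagliazzo–Paturi 2001, Lemma 2.
[cite: ImpagliazzoPaturiJCSS2001, Lemma 2 (p. 373)] -/
def NoLightSat (φ : KCNF k) (δ : ℝ) : Prop :=
  ∀ v : Fin φ.numVars → Bool, φ.evalFin v = true → δ * φ.numVars ≤ hammingNorm v

/-- If no satisfying assignment has at most `⌊δ n⌋` ones, then none has fewer than `δ n` ones. [folklore] -/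
theorem noLightSat_of_not_lightSatisfiable {φ : KCNF k} {δ : ℝ}
    (h : ¬ φ.LightSatisfiable ⌊δ * φ.numVars⌋₊) : φ.NoLightSat δ := by
  intro v hv
  have hlt : ⌊δ * φ.numVars⌋₊ < hammingNorm v := by
    by_contra hle
    exact h ⟨v, not_lt.1 hle, hv⟩
  exact (Nat.lt_of_floor_lt hlt).le

/-- The threshold `n / N` (natural division) is `⌊(1/N) · n⌋`; so if no satisfying assignment has
at most `n / N` ones then `φ.NoLightSat (1/N)`. [folklore] -/
theorem noLightSat_inv_of_not_lightSatisfiable {φ : KCNF k} {N : ℕ}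
    (h : ¬ φ.LightSatisfiable (φ.numVars / N)) : φ.NoLightSat (N : ℝ)⁻¹ := by
  refine noLightSat_of_not_lightSatisfiable ?_
  rwa [inv_mul_eq_div, Nat.floor_div_natCast, Nat.floor_natCast]

/-- The separator `Γ'.blank` does not occur in the encoding of a k-CNF (which uses `bit`,
`comma`, `bra`, `ket` only), so `KCNF.encodeList` is uniquely parsable. [folklore] -/
theorem blank_not_mem_encode (φ : KCNF k) : Γ'.blank ∉ φ.encode := by
  simp [encode, encodeClause, encodeLiteral, List.mem_flatMap]

/-- `KCNF.encodeList` is the separator-terminated concatenation of the encodings (definitional). [folklore] -/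
theorem encodeList_eq (l : List (KCNF k)) :
    encodeList l = l.flatMap fun φ => φ.encode ++ [Γ'.blank] :=
  rfl

end KCNF

/-! ### Elementary facts on `s_k` and `s_∞` -/

/-- `s_k ≤ ρ` as soon as every `ρ + η`, `η > 0`, is an admissible exponent ("since `ε` is
arbitrarily small, we get the desired bound for `s_k`", IP 2001 p. 369). [cite: ImpagliazzoPaturiJCSS2001, p. 369] -/
theorem satExponent_le_of_forall_pos {k : ℕ} {ρ : ℝ} (hρ : 0 ≤ ρ)
    (h : ∀ η : ℝ, 0 < η → KSATInExpTime k (ρ + η)) : satExponent k ≤ ρ :=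
  le_of_forall_pos_lt_add fun η hη =>
    ((h (η / 2) (by positivity)).satExponent_le (by positivity)).trans_lt (by linarith)

/-- `0 ≤ s_∞`. [cite: ImpagliazzoPaturiJCSS2001, §1 (p. 368)] -/
theorem satExponentLimit_nonneg : 0 ≤ satExponentLimit :=
  Real.iSup_nonneg satExponent_nonneg

section WithExhaustiveSearch

/-- Under `kSATInExpTime_one`: for every `ε > 0`, `k`-SAT has an algorithm of exponent
`δ < s_k + ε` (definition of the infimum of a nonempty set) — "use any algorithm that runs in
time at most `2^{(s_k' + ε) n'}`", IP 2001, proof of Theorem 3, step 4.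
[cite: ImpagliazzoPaturiJCSS2001, proof of Theorem 3, step 4 (p. 374)] -/
theorem exists_kSATInExpTime_lt (h₁ : kSATInExpTime_one) (k : ℕ) {ε : ℝ} (hε : 0 < ε) :
    ∃ δ : ℝ, 0 ≤ δ ∧ δ < satExponent k + ε ∧ KSATInExpTime k δ := by
  obtain ⟨δ, ⟨hδ0, hδ⟩, hlt⟩ :=
    Real.lt_sInf_add_pos (s := {δ : ℝ | 0 ≤ δ ∧ KSATInExpTime k δ}) ⟨1, zero_le_one, h₁ k⟩ hε
  exact ⟨δ, hδ0, hlt, hδ⟩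

end WithExhaustiveSearch

/-! ### `O(2^{ρ n} · poly(L))` bounds for functions of a k-CNF instance -/

namespace KCNF

variable {k : ℕ}

/-- `IsExpPolyDom ρ g`: the real-valued function `g` of a k-CNF instance is `O(2^{ρ n} · poly(L))`
uniformly, i.e. `g φ ≤ c · 2^{ρ n} · (L + 1)^d` for some constants `c, d`, where `n = φ.numVars`
and `L = |φ.encode|`. This is the instance-level form of `IsExpPolyBound` used to add up the
running times of the stages of a k-SAT algorithm. (Impagliazzo–Paturi 2001 §1: time bounds
`O(2^{δ n})` up to polynomial factors.) [folklore] -/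
def IsExpPolyDom (ρ : ℝ) (g : KCNF k → ℝ) : Prop :=
  ∃ c d : ℕ, ∀ φ : KCNF k,
    g φ ≤ c * (2 : ℝ) ^ (ρ * φ.numVars) * ((φ.encode.length : ℝ) + 1) ^ d

namespace IsExpPolyDom

variable {ρ ρ' ρ₁ ρ₂ : ℝ} {f g : KCNF k → ℝ}

/-- `1 ≤ 2^x` for `x ≥ 0`. [folklore] -/
private theorem one_le_two_rpow {x : ℝ} (hx : 0 ≤ x) : (1 : ℝ) ≤ (2 : ℝ) ^ x := by
  simpa using Real.rpow_le_rpow_of_exponent_le one_le_two hx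

/-- `1 ≤ L + 1`. [folklore] -/
private theorem one_le_length_succ (φ : KCNF k) : (1 : ℝ) ≤ (φ.encode.length : ℝ) + 1 := by
  simp

/-- An `IsExpPolyBound` time bound, read at `(numVars, |encode|)`, is `IsExpPolyDom`. [folklore] -/
theorem of_isExpPolyBound {T : ℕ → ℕ → ℕ} (h : IsExpPolyBound ρ T) :
    IsExpPolyDom ρ fun φ : KCNF k => (T φ.numVars φ.encode.length : ℝ) := by
  obtain ⟨c, hc⟩ := h
  exact ⟨c, c, fun φ => hc _ _⟩

/-- Monotonicity in the exponent. [folklore] -/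
theorem mono (h : IsExpPolyDom ρ g) (hρ : ρ ≤ ρ') : IsExpPolyDom ρ' g := by
  obtain ⟨c, d, h⟩ := h
  refine ⟨c, d, fun φ => (h φ).trans ?_⟩
  gcongr
  exact one_le_two

/-- Domination is inherited by pointwise smaller functions. [folklore] -/
theorem of_le (h : IsExpPolyDom ρ g) (hfg : ∀ φ, f φ ≤ g φ) : IsExpPolyDom ρ f := by
  obtain ⟨c, d, h⟩ := h
  exact ⟨c, d, fun φ => (hfg φ).trans (h φ)⟩

/-- Closure under addition (same exponent). [folklore] -/
theorem add (hf : IsExpPolyDom ρ f) (hg : IsExpPolyDom ρ g) :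
    IsExpPolyDom ρ fun φ => f φ + g φ := by
  obtain ⟨c₁, d₁, h₁⟩ := hf
  obtain ⟨c₂, d₂, h₂⟩ := hg
  refine ⟨c₁ + c₂, d₁ + d₂, fun φ => ?_⟩
  have hL := one_le_length_succ φ
  calc f φ + g φ
      ≤ c₁ * (2 : ℝ) ^ (ρ * φ.numVars) * ((φ.encode.length : ℝ) + 1) ^ d₁ +
          c₂ * (2 : ℝ) ^ (ρ * φ.numVars) * ((φ.encode.length : ℝ) + 1) ^ d₂ :=
        add_le_add (h₁ φ) (h₂ φ)
    _ ≤ c₁ * (2 : ℝ) ^ (ρ * φ.numVars) * ((φ.encode.length : ℝ) + 1) ^ (d₁ + d₂) +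
          c₂ * (2 : ℝ) ^ (ρ * φ.numVars) * ((φ.encode.length : ℝ) + 1) ^ (d₁ + d₂) := by
        gcongr
        · exact Nat.le_add_right _ _
        · exact Nat.le_add_left _ _
    _ = ((c₁ + c₂ : ℕ) : ℝ) * (2 : ℝ) ^ (ρ * φ.numVars) *
          ((φ.encode.length : ℝ) + 1) ^ (d₁ + d₂) := by
        push_cast; ring

/-- Closure under products of nonnegative functions: exponents add. [folklore] -/
theorem mul (hf : IsExpPolyDom ρ₁ f) (hg : IsExpPolyDom ρ₂ g) (hf0 : ∀ φ, 0 ≤ f φ)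
    (hg0 : ∀ φ, 0 ≤ g φ) : IsExpPolyDom (ρ₁ + ρ₂) fun φ => f φ * g φ := by
  obtain ⟨c₁, d₁, h₁⟩ := hf
  obtain ⟨c₂, d₂, h₂⟩ := hg
  refine ⟨c₁ * c₂, d₁ + d₂, fun φ => ?_⟩
  calc f φ * g φ
      ≤ (c₁ * (2 : ℝ) ^ (ρ₁ * φ.numVars) * ((φ.encode.length : ℝ) + 1) ^ d₁) *
          (c₂ * (2 : ℝ) ^ (ρ₂ * φ.numVars) * ((φ.encode.length : ℝ) + 1) ^ d₂) :=
        mul_le_mul (h₁ φ) (h₂ φ) (hg0 φ) ((hf0 φ).trans (h₁ φ))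
    _ = ((c₁ * c₂ : ℕ) : ℝ) * (2 : ℝ) ^ ((ρ₁ + ρ₂) * φ.numVars) *
          ((φ.encode.length : ℝ) + 1) ^ (d₁ + d₂) := by
        rw [add_mul, Real.rpow_add two_pos, pow_add]
        push_cast; ring

/-- Constants are dominated at every nonnegative exponent. [folklore] -/
theorem const (hρ : 0 ≤ ρ) (C : ℝ) : IsExpPolyDom ρ fun _ : KCNF k => C := by
  refine ⟨⌈C⌉₊, 0, fun φ => ?_⟩
  have h2 : (1 : ℝ) ≤ (2 : ℝ) ^ (ρ * φ.numVars) := one_le_two_rpow (by positivity)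
  calc C ≤ ⌈C⌉₊ := Nat.le_ceil C
    _ = (⌈C⌉₊ : ℝ) * 1 * 1 := by ring
    _ ≤ (⌈C⌉₊ : ℝ) * (2 : ℝ) ^ (ρ * φ.numVars) * ((φ.encode.length : ℝ) + 1) ^ 0 := by
        rw [pow_zero]
        gcongr

/-- A nonnegative constant multiple of a dominated function is dominated. [folklore] -/
theorem const_mul (C : ℝ) (hC : 0 ≤ C) (h : IsExpPolyDom ρ g) :
    IsExpPolyDom ρ fun φ => C * g φ := by
  obtain ⟨c, d, h⟩ := h
  refine ⟨⌈C⌉₊ * c, d, fun φ => ?_⟩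
  calc C * g φ ≤ C * (c * (2 : ℝ) ^ (ρ * φ.numVars) * ((φ.encode.length : ℝ) + 1) ^ d) :=
        mul_le_mul_of_nonneg_left (h φ) hC
    _ ≤ ⌈C⌉₊ * (c * (2 : ℝ) ^ (ρ * φ.numVars) * ((φ.encode.length : ℝ) + 1) ^ d) :=
        mul_le_mul_of_nonneg_right (Nat.le_ceil C) (by positivity)
    _ = ((⌈C⌉₊ * c : ℕ) : ℝ) * (2 : ℝ) ^ (ρ * φ.numVars) * ((φ.encode.length : ℝ) + 1) ^ d := by
        push_cast; ring

/-- The input length `L + 1` is dominated at every nonnegative exponent. [folklore] -/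
theorem length_succ (hρ : 0 ≤ ρ) :
    IsExpPolyDom ρ fun φ : KCNF k => (φ.encode.length : ℝ) + 1 := by
  refine ⟨1, 1, fun φ => ?_⟩
  have h2 : (1 : ℝ) ≤ (2 : ℝ) ^ (ρ * φ.numVars) := one_le_two_rpow (by positivity)
  calc (φ.encode.length : ℝ) + 1 = 1 * 1 * (((φ.encode.length : ℝ) + 1) ^ 1) := by ring
    _ ≤ ((1 : ℕ) : ℝ) * (2 : ℝ) ^ (ρ * φ.numVars) * ((φ.encode.length : ℝ) + 1) ^ 1 := by
        push_cast
        gcongr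

/-- **Summing over a produced list.** If `F φ` has `O(2^{ρ₁ n} poly(L))` entries, each entry `ψ`
has at most `a · n` variables and size `poly(L)`, and `g = O(2^{ρ₂ n'} poly(L'))` over
`k'`-CNFs with `ρ₂ ≥ 0` (so that the bound is monotone in `n'`), then `Σ_{ψ ∈ F φ} g ψ = O(2^{(ρ₁ + ρ₂ a) n} poly(L))` — the estimate
`2^{2εn} · 2^{(s_k' + ε)(1 - δ/(ek)) n}` of IP 2001, proof of Theorem 3.
[cite: ImpagliazzoPaturiJCSS2001, proof of Theorem 3 (p. 374), running-time estimate] -/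
theorem list_sum {k' : ℕ} {a : ℝ} {C : ℕ} {F : KCNF k → List (KCNF k')} {g : KCNF k' → ℝ}
    (hcount : IsExpPolyDom ρ₁ fun φ => ((F φ).length : ℝ))
    (hvars : ∀ φ, ∀ ψ ∈ F φ, (ψ.numVars : ℝ) ≤ a * φ.numVars)
    (hsize : ∀ φ, ∀ ψ ∈ F φ, (ψ.encode.length : ℝ) ≤ C * ((φ.encode.length : ℝ) + 1) ^ C)
    (hg : IsExpPolyDom ρ₂ g) (hρ₂ : 0 ≤ ρ₂) :
    IsExpPolyDom (ρ₁ + ρ₂ * a) fun φ => ((F φ).map g).sum := by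
  obtain ⟨c₂, d₂, h₂⟩ := hg
  -- uniform bound for the entries of `F φ`
  set B : KCNF k → ℝ := fun φ =>
    (c₂ * (C + 1) ^ d₂ : ℕ) * (2 : ℝ) ^ (ρ₂ * a * φ.numVars) *
      ((φ.encode.length : ℝ) + 1) ^ (C * d₂) with hB
  have hentry : ∀ φ, ∀ ψ ∈ F φ, g ψ ≤ B φ := by
    intro φ ψ hψ
    have hL := one_le_length_succ φ
    have hψL : (ψ.encode.length : ℝ) + 1 ≤ (C + 1) * ((φ.encode.length : ℝ) + 1) ^ C := by
      have := hsize φ ψ hψ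
      have h1 : (1 : ℝ) ≤ ((φ.encode.length : ℝ) + 1) ^ C := one_le_pow₀ hL
      nlinarith
    calc g ψ ≤ c₂ * (2 : ℝ) ^ (ρ₂ * ψ.numVars) * ((ψ.encode.length : ℝ) + 1) ^ d₂ := h₂ ψ
      _ ≤ c₂ * (2 : ℝ) ^ (ρ₂ * (a * φ.numVars)) *
            ((C + 1) * ((φ.encode.length : ℝ) + 1) ^ C) ^ d₂ := by
          gcongr
          · exact one_le_two
          · exact hvars φ ψ hψ
      _ = B φ := by
          rw [hB, mul_pow, ← pow_mul, ← mul_assoc ρ₂]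
          push_cast; ring
  have hB0 : ∀ φ, 0 ≤ B φ := fun φ => by rw [hB]; positivity
  -- sum ≤ length • bound, then multiply the two dominations
  have hsum : ∀ φ, ((F φ).map g).sum ≤ ((F φ).length : ℝ) * B φ := by
    intro φ
    have := List.sum_le_card_nsmul ((F φ).map g) (B φ) (by
      intro x hx
      obtain ⟨ψ, hψ, rfl⟩ := List.mem_map.1 hx
      exact hentry φ ψ hψ)
    simpa [nsmul_eq_mul] using this
  have hBdom : IsExpPolyDom (ρ₂ * a) B :=
    ⟨c₂ * (C + 1) ^ d₂, C * d₂, fun φ => by rw [hB]⟩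
  exact (hcount.mul hBdom (fun φ => Nat.cast_nonneg _) hB0).of_le hsum

end IsExpPolyDom

/-- **From an instance-level bound to `KSATInExpTime`.** A machine deciding k-SAT within `T φ`
steps, `T = O(2^{ρ n} poly(L))`, witnesses `KSATInExpTime k ρ`: replace `T` by the function
`(n, L) ↦ ⌊c · 2^{ρ n} (L + 1)^c⌋` of `(numVars, |encode|)` alone. [folklore] -/
theorem kSATInExpTime_of_isExpPolyDom {ρ : ℝ} {T : KCNF k → ℕ}
    (hT : IsExpPolyDom ρ fun φ => (T φ : ℝ))
    (hM : ComputesInTime KCNF.encode Computability.encodeBool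
      (fun φ : KCNF k => decide φ.Satisfiable) T) :
    KSATInExpTime k ρ := by
  obtain ⟨c, d, h⟩ := hT
  refine ⟨fun n L => ⌊((max c d : ℕ) : ℝ) * (2 : ℝ) ^ (ρ * n) * ((L : ℝ) + 1) ^ (max c d)⌋₊,
    ⟨max c d, fun n L => Nat.floor_le (by positivity)⟩, hM.mono_time fun φ => ?_⟩
  refine Nat.le_floor ((h φ).trans ?_)
  have hL : (1 : ℝ) ≤ (φ.encode.length : ℝ) + 1 := by simp
  gcongr
  · exact_mod_cast le_max_left c d
  · exact le_max_right c d

end KCNF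

/-! ### The named facts invoked by the proof of Theorem 3 -/

/-- **Exhaustive search of light assignments** (Impagliazzo–Paturi 2001, p. 370: "if a general
k-CNF has a satisfying assignment with at most `δ n` 1's, then such a satisfying assignment can be
found in time `2^{h(δ) n}` using exhaustive search, where `h(δ)` is the binary entropy function";
step 1 of the algorithm proving Theorem 3, p. 374), for `δ = 1/N`, `N ≥ 2`: some machine decides,
for every k-CNF `φ` on `n` variables, whether an assignment with at most `n / N` ones satisfies
`φ`, in time `2^{h(1/N) n} · poly(L)`, where `h(1/N) = binEntropy (1/N) / log 2` is the binary
entropy in bits (`Σ_{j ≤ n/N} (n choose j) ≤ 2^{h(1/N) n}` as `1/N ≤ 1/2`). The threshold is taken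
rational (`n / N`) so that the machine can compute it from `n`. As for Lemma 2 below, the
`poly(L)` (not `poly(n)`) slack is justified by the occurring-variables reduction: enumerate the
assignments of weight `≤ min(⌊n/N⌋, m)` of the `m ≤ L` occurring variables only (the others are
`false`), `Σ_{j ≤ ⌊n/N⌋} (m choose j) ≤ Σ_{j ≤ ⌊n/N⌋} (n choose j) ≤ 2^{h(1/N) n}` of them,
`poly(L)` steps each.
[cite: ImpagliazzoPaturiJCSS2001, p. 370 and proof of Theorem 3, step 1 (p. 374)] -/
def lightKSAT_exhaustiveSearch : Prop :=
  ∀ (k N : ℕ), 2 ≤ N →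
    ∃ T : ℕ → ℕ → ℕ, IsExpPolyBound (binEntropy (N : ℝ)⁻¹ / log 2) T ∧
      ComputesInTime KCNF.encode encodeBool
        (fun φ : KCNF k => decide (φ.LightSatisfiable (φ.numVars / N)))
        fun φ => T φ.numVars φ.encode.length

/-- **Impagliazzo–Paturi 2001, Lemma 2** (p. 373): "Let `F` be a k-CNF such that `F` is not
satisfiable by any assignment that contains fewer than `δ n` 1's. For any `ε > 0`, there exists
`k'` such that the following holds: the satisfiability of `F` is equivalent to the satisfiability
of `F̄`, where `F̄` is a disjunction of at most `2^{2εn}` `k'`-CNFs on at most `n (1 - δ/(ek))`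
variables. Moreover, `F̄` can be computed from `F` in time `poly(n) 2^{2εn}`." (Proof: the
sparsification lemma of Impagliazzo–Paturi–Zane, critical clauses of a minimal satisfying
assignment, a `k`-wise independent partition `(A, B)` forcing `≥ δ n/(ek)` variables of `B`, and
the slice-function rewriting of the unique-k-SAT case, `k' = c l k²`.)
Vendored form, for `k ≥ 3` (the paper's standing assumption) and real `δ, ε > 0`: a reduction
`F : KCNF k → List (KCNF k')` computable in time `2^{2εn} · poly(L)` producing, on every input,
at most `2^{2εn} · poly(L)` formulas, each of size `poly(L)` (implicit in the source: a `k'`-CNF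
over `≤ n` variables) and on at most `n (1 - δ/(3k))` variables — WEAKER than the printed
`n (1 - δ/(ek))` since `e ≤ 3` (the machine enumerates the vectors `(f_i)` with `Σ f_i` above a
threshold it must compute from `n`; a rational threshold in `[δn/(3k), δn/(ek)]` serves) — and,
under the hypothesis `φ.NoLightSat δ`, equisatisfiable with their disjunction. The two points
not printed (bounds holding on all inputs; size `poly(L)` of each output) follow from the
printed lemma applied to `φ` restricted to its `m ≤ L` occurring variables: the hypothesis
transfers since `δ m ≤ δ n`, the outputs have `≤ m (1 - δ/(ek)) ≤ n (1 - δ/(3k))` variables, a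
deduplicated `k'`-CNF on `≤ L` variables has size `poly(L)`, and the degenerate inputs (`δ > 1`,
where the hypothesis forces unsatisfiability for `n > 0`; no occurring variables) are served by
a trivial machine.
[cite: ImpagliazzoPaturiJCSS2001, Lemma 2 (p. 373)] -/
def impagliazzoPaturi_lemma2 : Prop :=
  ∀ (k : ℕ), 3 ≤ k → ∀ (δ ε : ℝ), 0 < δ → 0 < ε →
    ∃ (k' C : ℕ) (F : KCNF k → List (KCNF k')) (T : ℕ → ℕ → ℕ),
      IsExpPolyBound (2 * ε) T ∧
      ComputesInTime KCNF.encode KCNF.encodeList F (fun φ => T φ.numVars φ.encode.length) ∧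
      ∀ φ : KCNF k,
        ((F φ).length : ℝ) ≤
            C * (2 : ℝ) ^ (2 * ε * φ.numVars) * ((φ.encode.length : ℝ) + 1) ^ C ∧
        (∀ ψ ∈ F φ, (ψ.numVars : ℝ) ≤ (1 - δ / (3 * k)) * φ.numVars ∧
          (ψ.encode.length : ℝ) ≤ C * ((φ.encode.length : ℝ) + 1) ^ C) ∧
        (φ.NoLightSat δ → (φ.Satisfiable ↔ ∃ ψ ∈ F φ, ψ.Satisfiable))

/-- **OR of two deciders on the same input** (machine composition; Arora–Barak 2009, §1.3): if
Boolean functions `P` and `Q` of `a` are computed from the word `ea a` (over an inhabited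
alphabet) within `T₁ a`, resp. `T₂ a`, steps by multi-stack machines (`Turing.FinTM2`, exact
halting convention `Turing.haltList`), then some machine computes `P a || Q a` within
`c · (T₁ a + T₂ a + |ea a| + 1)` steps for a constant `c` (here `c = 4`: the disjunction machine
`Turing.TM2ComputableAux.orMachine` of `TM2Disjunction.lean` takes `T₁ a + T₂ a + 2|ea a| + 4`
steps, `or_outputsWithin`). This is the composition of steps 1–2 with steps 3–5 in the proof of
IP 2001, Theorem 3. [cite: AroraBarak2009, §1.3 (multi-tape machine constructions; composition)] -/
theorem computesInTime_or {α Γ₀ : Type} [Inhabited Γ₀] {ea : α → List Γ₀} {P Q : α → Bool}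
    {T₁ T₂ : α → ℕ} (hP : ComputesInTime ea encodeBool P T₁) (hQ : ComputesInTime ea encodeBool Q T₂) :
    ∃ c : ℕ, ComputesInTime ea encodeBool (fun a => P a || Q a)
      fun a => c * (T₁ a + T₂ a + (ea a).length + 1) := by
  obtain ⟨M₁, h₁⟩ := hP
  obtain ⟨M₂, h₂⟩ := hQ
  refine ⟨4, M₁.orMachine M₂, fun a => ?_⟩
  have H := TM2ComputableAux.or_outputsWithin M₁ M₂ (l := ea a) (b₁ := P a) (b₂ := Q a)
    (m₁ := T₁ a) (m₂ := T₂ a) (h₁ a) (h₂ a)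
  exact H.mono (show T₁ a + T₂ a + 2 * (ea a).length + 4 ≤ 4 * (T₁ a + T₂ a + (ea a).length + 1) by
    omega)

/-- **OR of a decider over a computed list** (machine composition; Arora–Barak 2009, §1.3;
alphabets inhabited): if `F : α → List β` is computed within `T₁ a` steps with the output list
written as the `sep`-terminated concatenation of the encodings `eb b` (`sep` not occurring in
any `eb b`), and the Boolean function `Q` is computed from `eb b` within `T₂ b` steps, then
some machine computes `(F a).any Q` — "accept iff one of the `F_i` is accepted" — within
`c · (T₁ a + Σ_{b ∈ F a} (T₂ b + |eb b| + 1) + |ea a| + 1)` steps for a constant `c` (here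
`c = 3`: the machine `Turing.TM2ComputableAux.anyMachine` of `TM2AnyList.lean` takes
`T₁ a + Σ_b (T₂ b + 2 |eb b| + 3) + 2` steps, `any_outputsWithin`). Steps 3–5 of the proof of
IP 2001, Theorem 3. [cite: AroraBarak2009, §1.3 (multi-tape machine constructions; composition)] -/
theorem computesInTime_any {α β Γ₀ Γ₁ : Type} [Inhabited Γ₀] [Inhabited Γ₁] {ea : α → List Γ₀}
    {eb : β → List Γ₁} {sep : Γ₁} {F : α → List β} {Q : β → Bool} {T₁ : α → ℕ} {T₂ : β → ℕ}
    (hsep : ∀ b, sep ∉ eb b)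
    (hF : ComputesInTime ea (fun l : List β => l.flatMap fun b => eb b ++ [sep]) F T₁)
    (hQ : ComputesInTime eb encodeBool Q T₂) :
    ∃ c : ℕ, ComputesInTime ea encodeBool (fun a => (F a).any Q)
      fun a => c * (T₁ a + ((F a).map fun b => T₂ b + (eb b).length + 1).sum +
        (ea a).length + 1) := by
  obtain ⟨M₁, h₁⟩ := hF
  obtain ⟨M₂, h₂⟩ := hQ
  refine ⟨3, M₁.anyMachine M₂ sep, fun a => ?_⟩
  have H := TM2ComputableAux.any_outputsWithin M₁ M₂ (sep := sep) (w := eb) (q := Q) (m := T₂)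
    hsep (l := ea a) (bs := F a) (m₁ := T₁ a) (h₁ a) (fun b => h₂ b)
  have hs : ((F a).map fun b => T₂ b + 2 * (eb b).length + 3).sum ≤
      3 * ((F a).map fun b => T₂ b + (eb b).length + 1).sum := by
    rw [← List.sum_map_mul_left]
    exact List.sum_le_sum fun b _ => by omega
  exact H.mono (show _ ≤ 3 * (T₁ a + ((F a).map fun b => T₂ b + (eb b).length + 1).sum +
    (ea a).length + 1) by omega)

/-! ### Theorem 3: the assembly -/

section Assembly

variable (h₁ : kSATInExpTime_one) (h₂ : lightKSAT_exhaustiveSearch)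
  (h₃ : impagliazzoPaturi_lemma2)

include h₁ h₂ h₃ in
/-- **The algorithm of IP 2001, Theorem 3, for fixed parameters.** For `k ≥ 3`, `N ≥ 2`
(`δ = 1/N`) and every `η > 0`, k-SAT is decidable with exponent
`max (h(1/N), (1 - 1/(3kN)) s_∞) + η`: search the light assignments (exponent `h(1/N)`),
otherwise apply Lemma 2 with `ε = η/4` and solve each produced `k'`-CNF with an algorithm of
exponent `< s_k' + ε ≤ s_∞ + ε` on `≤ (1 - 1/(3kN)) n` variables.
[cite: ImpagliazzoPaturiJCSS2001, proof of Theorem 3 (p. 374)] -/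
theorem kSATInExpTime_of_lightSearch_lemma2 {k N : ℕ} (hk : 3 ≤ k) (hN : 2 ≤ N) {η : ℝ}
    (hη : 0 < η) :
    KSATInExpTime k
      (max (binEntropy (N : ℝ)⁻¹ / log 2) ((1 - (N : ℝ)⁻¹ / (3 * k)) * satExponentLimit) + η) := by
  -- parameters
  set hδ : ℝ := binEntropy (N : ℝ)⁻¹ / log 2 with hhδ
  set a : ℝ := 1 - (N : ℝ)⁻¹ / (3 * k) with ha
  set s : ℝ := satExponentLimit with hs
  have hk0 : (0 : ℝ) < k := by exact_mod_cast (show 0 < k by omega)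
  have hN0 : (0 : ℝ) < N := by exact_mod_cast (show 0 < N by omega)
  have hNinv : (0 : ℝ) < (N : ℝ)⁻¹ := inv_pos.2 hN0
  have ha0 : 0 ≤ a := by
    rw [ha, sub_nonneg, div_le_one (by positivity)]
    calc (N : ℝ)⁻¹ ≤ 1 := inv_le_one_of_one_le₀ (by exact_mod_cast (show 1 ≤ N by omega))
      _ ≤ 3 * k := by nlinarith [show (3 : ℝ) ≤ k by exact_mod_cast hk]
  have ha1 : a ≤ 1 := by rw [ha]; linarith [div_nonneg hNinv.le (by positivity : (0:ℝ) ≤ 3 * k)]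
  have hs0 : 0 ≤ s := satExponentLimit_nonneg
  have hhδ0 : 0 ≤ hδ := div_nonneg
    (binEntropy_nonneg hNinv.le ((inv_le_one_of_one_le₀
      (by exact_mod_cast (show 1 ≤ N by omega))))) (log_nonneg one_le_two)
  set ε : ℝ := η / 4 with hεdef
  have hε : 0 < ε := by positivity
  -- step 1: light search
  obtain ⟨T₃, hT₃, hM₃⟩ := h₂ k N hN
  -- step 3: Lemma 2 with `δ = 1/N`
  obtain ⟨k', C, F, T_F, hT_F, hM_F, hF⟩ := h₃ k hk (N : ℝ)⁻¹ ε hNinv hε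
  -- step 4: a `k'`-SAT algorithm of exponent `δ' < s_k' + ε`
  obtain ⟨δ', hδ'0, hδ'lt, T_D, hT_D, hM_D⟩ := exists_kSATInExpTime_lt h₁ k' hε
  have hδ's : δ' ≤ s + ε := by
    have := satExponent_le_satExponentLimit_of_kSATInExpTime_one h₁ k'
    rw [hs]; linarith
  -- steps 3–5 as one machine: OR over the produced list
  obtain ⟨c₅, hM₅⟩ := computesInTime_any (sep := Γ'.blank) (F := F)
    (Q := fun ψ : KCNF k' => decide ψ.Satisfiable) (fun ψ => ψ.blank_not_mem_encode) hM_F hM_D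
  -- steps 1–5: OR of the light search and of the Lemma-2 branch
  obtain ⟨c₄, hM⟩ := computesInTime_or hM₃ hM₅
  -- correctness
  have hcorrect : ∀ φ : KCNF k,
      (decide (φ.LightSatisfiable (φ.numVars / N)) ||
        (F φ).any fun ψ => decide ψ.Satisfiable) = decide φ.Satisfiable := by
    intro φ
    by_cases hl : φ.LightSatisfiable (φ.numVars / N)
    · simp [hl, hl.satisfiable]
    · have hiff := (hF φ).2.2 (KCNF.noLightSat_inv_of_not_lightSatisfiable hl)
      simp only [hl, decide_false, Bool.false_or]
      by_cases hsat : φ.Satisfiable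
      · obtain ⟨ψ, hψ, hψs⟩ := hiff.1 hsat
        simp only [hsat, decide_true, List.any_eq_true, decide_eq_true_eq]
        exact ⟨ψ, hψ, hψs⟩
      · have : ¬ ∃ ψ ∈ F φ, ψ.Satisfiable := fun h => hsat (hiff.2 h)
        simp only [hsat, decide_false, Bool.eq_false_iff, ne_eq, List.any_eq_true,
          decide_eq_true_eq]
        exact this
  have hM' := hM.congr_fun hcorrect
  -- running time
  refine KCNF.kSATInExpTime_of_isExpPolyDom ?_ hM'
  set ρ : ℝ := max hδ (a * s) + η with hρdef
  have hρ0 : 0 ≤ ρ := by positivity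
  have hρ1 : hδ ≤ ρ := (le_max_left _ _).trans (le_add_of_nonneg_right hη.le)
  have hρ2 : 2 * ε ≤ ρ := by
    rw [hρdef, hεdef]; linarith [le_max_right hδ (a * s), mul_nonneg ha0 hs0]
  have hρ3 : 2 * ε + δ' * a ≤ ρ := by
    have : δ' * a ≤ (s + ε) * a := mul_le_mul_of_nonneg_right hδ's ha0
    have : ε * a ≤ ε := by nlinarith
    rw [hρdef, hεdef] at *
    nlinarith [le_max_right hδ (a * s), mul_nonneg ha0 hs0]
  -- the three stages
  have D₃ : KCNF.IsExpPolyDom ρ fun φ : KCNF k => (T₃ φ.numVars φ.encode.length : ℝ) :=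
    (KCNF.IsExpPolyDom.of_isExpPolyBound hT₃).mono hρ1
  have D_F : KCNF.IsExpPolyDom ρ fun φ : KCNF k => (T_F φ.numVars φ.encode.length : ℝ) :=
    (KCNF.IsExpPolyDom.of_isExpPolyBound hT_F).mono hρ2
  have D_L : KCNF.IsExpPolyDom ρ fun φ : KCNF k => (φ.encode.length : ℝ) + 1 :=
    KCNF.IsExpPolyDom.length_succ hρ0
  set S' : KCNF k → ℝ := fun φ =>
    ((F φ).map fun ψ => (T_D ψ.numVars ψ.encode.length : ℝ) + (ψ.encode.length : ℝ) + 1).sum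
    with hS'
  have D_sum : KCNF.IsExpPolyDom ρ S' := by
    have hg : KCNF.IsExpPolyDom δ' fun ψ : KCNF k' =>
        (T_D ψ.numVars ψ.encode.length : ℝ) + (ψ.encode.length : ℝ) + 1 := by
      have := (KCNF.IsExpPolyDom.of_isExpPolyBound hT_D).add
        (KCNF.IsExpPolyDom.length_succ (k := k') hδ'0)
      exact this.of_le fun ψ => by linarith
    have hcount : KCNF.IsExpPolyDom (2 * ε) fun φ : KCNF k => ((F φ).length : ℝ) :=
      ⟨C, C, fun φ => (hF φ).1⟩
    exact (KCNF.IsExpPolyDom.list_sum hcount (fun φ ψ hψ => ((hF φ).2.1 ψ hψ).1)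
      (fun φ ψ hψ => ((hF φ).2.1 ψ hψ).2) hg hδ'0).mono hρ3
  -- total running time of the final machine, as a real function of the instance
  have D : KCNF.IsExpPolyDom ρ fun φ : KCNF k =>
      (c₄ : ℝ) * ((T₃ φ.numVars φ.encode.length : ℝ) +
        (c₅ : ℝ) * ((T_F φ.numVars φ.encode.length : ℝ) + S' φ + ((φ.encode.length : ℝ) + 1)) +
        ((φ.encode.length : ℝ) + 1)) :=
    KCNF.IsExpPolyDom.const_mul _ (Nat.cast_nonneg _)
      ((D₃.add (KCNF.IsExpPolyDom.const_mul _ (Nat.cast_nonneg _)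
        ((D_F.add D_sum).add D_L))).add D_L)
  refine D.of_le fun φ => le_of_eq ?_
  rw [hS']
  push_cast [List.map_map, Function.comp_def]
  ring

include h₁ h₂ h₃ in
/-- **Impagliazzo–Paturi 2001, Theorem 3** (`s_k ≤ (1 - d/k) s_∞` for an absolute constant
`d > 0` and all `k ≥ 3`), assembled from exhaustive search (`kSATInExpTime_one`,
`lightKSAT_exhaustiveSearch`), Lemma 2 (`impagliazzoPaturi_lemma2`) and the machine
compositions `computesInTime_or`, `computesInTime_any`: if `s_∞ = 0` any `d` works (`s_k ≤ s_∞`); otherwise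
choose `N ≥ 2` with `h(1/N) ≤ s_∞ / 2` (continuity of the binary entropy at `0`) and take
`d = 1/(3N)`, so that for every `η > 0` the algorithm of `kSATInExpTime_of_lightSearch_lemma2` has
exponent `max (h(1/N), (1 - d/k) s_∞) + η = (1 - d/k) s_∞ + η`.
[cite: ImpagliazzoPaturiJCSS2001, Theorem 3 (p. 374)] -/
theorem satExponent_le_satExponentLimit_of : satExponent_le_satExponentLimit := by
  by_cases hs : satExponentLimit = 0
  · refine ⟨1, one_pos, fun k _ => ?_⟩
    rw [hs, mul_zero]
    exact (satExponent_le_satExponentLimit_of_kSATInExpTime_one h₁ k).trans_eq hs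
  have hs0 : 0 < satExponentLimit := lt_of_le_of_ne satExponentLimit_nonneg (Ne.symm hs)
  -- `N ≥ 2` with `h(1/N) ≤ s_∞ / 2`
  obtain ⟨N, hN, hN2⟩ : ∃ N : ℕ,
      binEntropy (N : ℝ)⁻¹ / log 2 < satExponentLimit / 2 ∧ 2 ≤ N := by
    have h0 : Tendsto (fun N : ℕ => (N : ℝ)⁻¹) atTop (𝓝 0) := tendsto_inv_atTop_nhds_zero_nat (𝕜 := ℝ)
    have ht : Tendsto (fun N : ℕ => binEntropy (N : ℝ)⁻¹ / log 2) atTop (𝓝 (binEntropy 0 / log 2)) :=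
      ((binEntropy_continuous.div_const (log 2)).tendsto 0).comp h0
    rw [binEntropy_zero, zero_div] at ht
    exact ((ht.eventually_mem (Iio_mem_nhds (by positivity))).and (eventually_ge_atTop 2)).exists
  refine ⟨(N : ℝ)⁻¹ / 3, by positivity, fun k hk => ?_⟩
  have hk0 : (0 : ℝ) < k := by exact_mod_cast (show 0 < k by omega)
  have hN0 : (0 : ℝ) < N := by exact_mod_cast (show 0 < N by omega)
  have ha : 1 - (N : ℝ)⁻¹ / 3 / k = 1 - (N : ℝ)⁻¹ / (3 * k) := by
    rw [div_div]
  rw [ha]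
  set a : ℝ := 1 - (N : ℝ)⁻¹ / (3 * k) with hadef
  -- `h(1/N) ≤ s_∞ / 2 ≤ a s_∞` since `a ≥ 1/2`
  have ha2 : (1 : ℝ) / 2 ≤ a := by
    rw [hadef]
    have : (N : ℝ)⁻¹ / (3 * k) ≤ 1 / 2 := by
      rw [div_le_div_iff₀ (by positivity) two_pos]
      have hN1 : (N : ℝ)⁻¹ ≤ 1 := inv_le_one_of_one_le₀ (by exact_mod_cast (show 1 ≤ N by omega))
      nlinarith [show (3 : ℝ) ≤ k by exact_mod_cast hk]
    linarith
  have hmax : max (binEntropy (N : ℝ)⁻¹ / log 2) (a * satExponentLimit) = a * satExponentLimit :=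
    max_eq_right (by nlinarith)
  have ha0 : 0 ≤ a := by linarith
  refine satExponent_le_of_forall_pos (mul_nonneg ha0 satExponentLimit_nonneg) fun η hη => ?_
  have := kSATInExpTime_of_lightSearch_lemma2 h₁ h₂ h₃ hk hN2 hη
  rwa [hmax] at this

end Assembly

end Literature.Computability.FineGrained
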